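import Literature.NumberTheory.Automorphic.SymCoeffLattice
import Literature.NumberTheory.Automorphic.LevelActionSemilinearPushforward
import Literature.NumberTheory.Automorphic.LevelActionCoefficientEquiv
import Literature.NumberTheory.Automorphic.ParallelWeightLevelActionComparison
import Literature.NumberTheory.Automorphic.PadicEmbeddingCoefficientRing
import Literature.NumberTheory.Automorphic.SymWeightCoefficients
import HarnessLib

/-!
# The coefficient passages `𝒪/I ← 𝒪 → ℚ̄_p` on `H^i(U, ⨂_τ Sym^{k−2})`, Hecke-equivariantly

Topic `NumberTheory/Automorphic`; namespace `Literature.NumberTheory.Automorphic.ParallelWeight`;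
definitions with bodies and theorems.  The two changes of coefficient RING of Hida theory for
`Res_{F/ℚ} GL₂` on the cohomology of the `𝒪`-lattice `⨂_τ Sym^{k−2}(𝒪²)` (`SymCoeffLattice`,
coefficients-at-`p` model `LevelAction.cohomology` for the integral monoid), as SEMILINEAR maps
commuting with the Hecke operators (`LevelActionSemilinearPushforward`):

* reduction: `latticeReduce I : ⨂_τ Sym(𝒪²) →ₛₗ[𝒪 → 𝒪/I] ⨂_τ Sym((𝒪/I)²)` (`latticeQuotEquiv` after
  the quotient map), equivariant (`latticeReduce_symLatticeAction`), and
  **`reductionCohomology I i : H^i(U, ⨂_τ Sym(𝒪²)) →ₛₗ H^i(U, ⨂_τ Sym((𝒪/I)²))`** with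
  `reductionCohomology_heckeCohomology`, `mapsTo_reductionCohomology_ordinaryPart`
  ([Hida1994AIF, §2, (2.2)]; [KhareThorne2017, §6.3]);
* characteristic `0`, for `𝒪 = padicEmbInt F p ⊆ ℚ̄_p` (`PadicEmbeddingCoefficientRing`) and the
  chosen `p`-adic place data: `padicEmbIntToAlgCl : 𝒪 → ℚ̄_p`,
  `latticeToCoeffCohomology i : H^i(U, ⨂_τ Sym(𝒪²)) →ₛₗ H^i(U, ⨂_τ Sym(ℚ̄_p²))`, the identification
  `symCoeffCohomologyIso` of the latter with the coefficients-at-`p` cohomology of the fact's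
  coefficients `⨂_τ V_{(k−2,0)}(ℚ̄_p)` (`symCoeffEquiv`, `LevelActionCoefficientEquiv`), and
  **`latticeToParallelWeight i : H^i(U, ⨂_τ Sym(𝒪²)) →ₛₗ H^i(X_U, Ṽ_{symWeight k}(ℚ̄_p))`**
  (through `levelActionIso`) with **`latticeToParallelWeight_heckeCohomology`:
  `Φ([UαU] x) = heckeOp … α (Φ x)`** for `α` in the integral monoid — the receptacle and the Hecke
  operators `heckeT` of `hidaControl_dominantOrdinaryPoint` ([Hida1994AIF, §1, §3];
  [KhareThorne2017, §6.4–6.5]).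

## References

* H. Hida, Ann. Inst. Fourier 44 (1994), §1–§3 (held). [Hida1994AIF]
* C. Khare, J. A. Thorne, Amer. J. Math. 139 (2017), §6.3–6.5 (arXiv:1409.7007, held). [KhareThorne2017]
-/

noncomputable section

open CategoryTheory IsDedekindDomain NumberField

namespace Literature.NumberTheory.Automorphic.ParallelWeight

open BigHeckeGLn IntegralWeightGL2 LevelAction

/-! ### Reduction modulo an ideal -/

section Reduction

variable (O : Type) [CommRing O] (E : Type) [Field E] [CharZero E] (F : Type) [Field F] [NumberField F]
  (k : ℕ) (v : (F →+* E) → HeightOneSpectrum (𝓞 F))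
  (φO : ∀ τ : F →+* E, (v τ).adicCompletionIntegers F →+* O) (I : Ideal O)

variable {O} in
/-- An `𝒪`-linear map into an `𝒪/I`-module is `(𝒪 → 𝒪/I)`-semilinear. [folklore] -/
def toQuotSemilinear {M N : Type} [AddCommGroup M] [Module O M] [AddCommGroup N] [Module (O ⧸ I) N]
    [Module O N] [IsScalarTower O (O ⧸ I) N] (f : M →ₗ[O] N) : M →ₛₗ[Ideal.Quotient.mk I] N where
  toFun := f
  map_add' := f.map_add
  map_smul' r m := by
    rw [f.map_smul, ← IsScalarTower.algebraMap_smul (O ⧸ I) r (f m), Ideal.Quotient.algebraMap_eq]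

/-- **The reduction `⨂_τ Sym^{k−2}(𝒪²) → ⨂_τ Sym^{k−2}((𝒪/I)²)`** (`latticeQuotEquiv` after the quotient
map), a semilinear map over `𝒪 → 𝒪/I`. [cite: Hida1994AIF, §1, (1.2b)] -/
def latticeReduce : SymCoeffLattice O E F k →ₛₗ[Ideal.Quotient.mk I] SymCoeffLattice (O ⧸ I) E F k :=
  toQuotSemilinear I ((latticeQuotEquiv O E F k I).toLinearMap ∘ₗ
    (I • (⊤ : Submodule O (SymCoeffLattice O E F k))).mkQ)

/-- Unfolding `latticeReduce`. [folklore] -/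
@[simp]
theorem latticeReduce_apply (x : SymCoeffLattice O E F k) :
    latticeReduce O E F k I x = latticeQuotEquiv O E F k I (Submodule.Quotient.mk x) :=
  rfl

/-- `latticeReduce` on pure tensors is coefficientwise reduction. [folklore] -/
theorem latticeReduce_ltprod (x : (F →+* E) → SymPow O (k - 2)) :
    latticeReduce O E F k I (ltprod x) = ltprod fun τ => symPowMap (Ideal.Quotient.mk I) (k - 2) (x τ) :=
  latticeQuotEquiv_mk_tprod O E F k I x

/-- **`latticeReduce` is equivariant** for the integral actions (place maps `φO_τ` and `φO_τ mod I`).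
[cite: KhareThorne2017, §6.4] -/
theorem latticeReduce_symLatticeAction (g : integralMonoid F v) (x : SymCoeffLattice O E F k) :
    latticeReduce O E F k I (symLatticeAction O E F k v φO g x) =
      symLatticeAction (O ⧸ I) E F k v (fun τ => (Ideal.Quotient.mk I).comp (φO τ)) g
        (latticeReduce O E F k I x) := by
  rw [latticeReduce_apply, latticeReduce_apply, ← latticeQuotEquiv_symLatticeAction, Submodule.mapQ_apply]

variable {Γ : Type} [Group Γ] (ι : Γ →* FiniteAdelicGL 2 F) {U : Subgroup (FiniteAdelicGL 2 F)}
  (hU : U.toSubmonoid ≤ integralMonoid F v) (i : ℕ)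

/-- **Reduction of coefficients on cohomology `H^i(U, ⨂_τ Sym(𝒪²)) → H^i(U, ⨂_τ Sym((𝒪/I)²))`.**
[cite: Hida1994AIF, §2, (2.2)] [cite: KhareThorne2017, §6.3] -/
def reductionCohomology :
    LevelAction.cohomology ι (integralMonoid F v) (symLatticeAction O E F k v φO) U i →ₛₗ[Ideal.Quotient.mk I]
      LevelAction.cohomology ι (integralMonoid F v)
        (symLatticeAction (O ⧸ I) E F k v (fun τ => (Ideal.Quotient.mk I).comp (φO τ))) U i :=
  cohomologySemimap ι (integralMonoid F v) _ _ U hU (latticeReduce O E F k I)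
    (fun g x => latticeReduce_symLatticeAction O E F k v φO I g x) i

/-- **Reduction commutes with the Hecke operators** `[U α U]`, `α` in the integral monoid. [folklore] -/
theorem reductionCohomology_heckeCohomology {α : FiniteAdelicGL 2 F} (hα : α ∈ integralMonoid F v)
    (x : LevelAction.cohomology ι (integralMonoid F v) (symLatticeAction O E F k v φO) U i) :
    reductionCohomology O E F k v φO I ι hU i (heckeCohomology ι _ _ U hU hα i x) =
      heckeCohomology ι _ _ U hU hα i (reductionCohomology O E F k v φO I ι hU i x) :=
  cohomologySemimap_heckeCohomology ι _ _ _ U hU _ _ hα i x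

/-- Reduction maps `[U α U]`-ordinary parts into ordinary parts. [folklore] -/
theorem mapsTo_reductionCohomology_ordinaryPart {α : FiniteAdelicGL 2 F} (hα : α ∈ integralMonoid F v) :
    Set.MapsTo (reductionCohomology O E F k v φO I ι hU i)
      (⨅ n : ℕ, LinearMap.range (heckeCohomology ι (integralMonoid F v) (symLatticeAction O E F k v φO) U hU hα i ^ n) :
        Submodule O _)
      (⨅ n : ℕ, LinearMap.range (heckeCohomology ι (integralMonoid F v)
        (symLatticeAction (O ⧸ I) E F k v (fun τ => (Ideal.Quotient.mk I).comp (φO τ))) U hU hα i ^ n) :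
        Submodule (O ⧸ I) _) :=
  mapsTo_cohomologySemimap_ordinaryPart ι _ _ _ U hU _ _ hα i

end Reduction

/-! ### Change of the coefficient ring along `σ : 𝒪 → 𝒪'` (generic) -/

section Change

variable (O : Type) [CommRing O] (O' : Type) [CommRing O'] (E : Type) [Field E] (F : Type) [Field F]
  [NumberField F] (k : ℕ) (v : (F →+* E) → HeightOneSpectrum (𝓞 F))
  (φO : ∀ τ : F →+* E, (v τ).adicCompletionIntegers F →+* O) (σ : O →+* O')

/-- **`⨂_τ Sym^{k−2}(𝒪²) →ₛₗ[σ] ⨂_τ Sym^{k−2}(𝒪'²)`**, coefficientwise `σ` in each factor (between the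
wrappers). [cite: KhareThorne2017, §6.4 (M_𝛌 ⊗_𝒪 ·)] -/
def latticeChange : SymCoeffLattice O E F k →ₛₗ[σ] SymCoeffLattice O' E F k :=
  show (PiTensorProduct O fun _ : F →+* E => SymPow O (k - 2)) →ₛₗ[σ]
      (PiTensorProduct O' fun _ : F →+* E => SymPow O' (k - 2)) from
    Literature.LinearAlgebra.Semilinear.PiTensorProduct.semimap fun _ => symPowMap σ (k - 2)

omit [NumberField F] in
/-- `latticeChange` on pure tensors. [folklore] -/
@[simp]
theorem latticeChange_ltprod (x : (F →+* E) → SymPow O (k - 2)) :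
    latticeChange O O' E F k σ (ltprod x) = ltprod fun τ => symPowMap σ (k - 2) (x τ) :=
  Literature.LinearAlgebra.Semilinear.PiTensorProduct.semimap_tprod _ x

/-- **`latticeChange` is equivariant** for the integral actions with place maps `φO_τ` and
`σ ∘ φO_τ`. [cite: KhareThorne2017, §6.4] -/
theorem latticeChange_symLatticeAction (g : integralMonoid F v) (x : SymCoeffLattice O E F k) :
    latticeChange O O' E F k σ (symLatticeAction O E F k v φO g x) =
      symLatticeAction O' E F k v (fun τ => σ.comp (φO τ)) g (latticeChange O O' E F k σ x) := by
  induction x using SymCoeffLattice.induction_on with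
  | smul_tprod r x =>
    rw [map_smul, map_smulₛₗ, map_smulₛₗ, map_smul, symLatticeAction_tprod, latticeChange_ltprod,
      latticeChange_ltprod, symLatticeAction_tprod]
    congr 1
    refine congrArg ltprod (funext fun τ => ?_)
    rw [symPowMap_symPowAction, intMatrixAt_map]
  | add y z hy hz => rw [map_add, map_add, map_add, hy, hz, map_add]

variable [CharZero E]

/-- For `𝒪' = E`, `latticeChange σ` is `latticeToCoeff σ` (same function), hence injective for
injective `σ`. [folklore] -/
theorem latticeChange_injective (σE : O →+* E) (hσ : Function.Injective σE) :
    Function.Injective (latticeChange O E E F k σE) :=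
  latticeToCoeff_injective O E F k σE hσ

end Change

/-! ### The `SymPow` model versus the fact's coefficients `⨂_τ V_{(k−2,0)}(E)` (generic `E`) -/

section Rational

variable (E : Type) [Field E] (F : Type) [Field F] [NumberField F] (k : ℕ)
  (v : (F →+* E) → HeightOneSpectrum (𝓞 F)) (φ : ∀ τ : F →+* E, (v τ).adicCompletion F →+* E)

/-- The place maps restricted to integers `φ_τ|_{𝒪_{v(τ)}}`. [folklore] -/
def placeHomInt (τ : F →+* E) : (v τ).adicCompletionIntegers F →+* E :=
  (φ τ).comp ((v τ).adicCompletionIntegers F).subtype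

/-- The rational integral matrix at `τ` is `GL₂(φ_τ)(g_{v(τ)})`. [folklore] -/
theorem intMatrixAt_placeHomInt (τ : F →+* E) (g : integralMonoid F v) :
    intMatrixAt E F v (placeHomInt E F v φ) τ g =
      ((Matrix.GeneralLinearGroup.map (φ τ) (localComponent 2 F (v τ) g) : GL (Fin 2) E) :
        Matrix (Fin 2) (Fin 2) E) := by
  rw [← intMatrixAt_map_eq E F v (placeHomInt E F v φ) (RingHom.id _) φ (fun _ _ => rfl) τ g,
    RingHom.coe_id, Matrix.map_id]

variable [CharZero E]

/-- **`⨂_τ Sym^{k−2}(E²) ≃ ⨂_τ V_{(k−2,0)}(E)`** (`symCoeffEquiv⁻¹`, on the wrapper). [folklore] -/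
def symLatticeEquivCoeff : SymCoeffLattice E E F k ≃ₗ[E] CoeffModule E F 2 (symWeight k) :=
  (symCoeffEquiv E F k).symm

omit [NumberField F] in
/-- `symLatticeEquivCoeff⁻¹` on pure tensors. [folklore] -/
theorem symLatticeEquivCoeff_symm_tprod (x : (F →+* E) → GLnCohomology.CoeffModule E 2 (symWeight k)) :
    (symLatticeEquivCoeff E F k).symm (PiTensorProduct.tprod E x) =
      ltprod fun τ => GLnCohomology.symWeightEquiv E k (x τ) :=
  symCoeffEquiv_tprod E F k x

/-- **`symLatticeEquivCoeff` intertwines the integral action (rational place maps) with the fact's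
finite-adelic action `adelicCoeffRep`.** [cite: Hida1994AIF, §1] -/
theorem symLatticeEquivCoeff_equivariant (δ : integralMonoid F v) :
    (symLatticeEquivCoeff E F k : SymCoeffLattice E E F k →ₗ[E] CoeffModule E F 2 (symWeight k)) ∘ₗ
        symLatticeAction E E F k v (placeHomInt E F v φ) δ =
      adelicCoeffRep E F 2 (symWeight k) v φ δ ∘ₗ
        (symLatticeEquivCoeff E F k : SymCoeffLattice E E F k →ₗ[E] CoeffModule E F 2 (symWeight k)) := by
  -- compare after applying the inverse equivalence, on pure tensors of the fact's coefficients
  have h : ∀ w : CoeffModule E F 2 (symWeight k),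
      symLatticeEquivCoeff E F k (symLatticeAction E E F k v (placeHomInt E F v φ) δ ((symLatticeEquivCoeff E F k).symm w)) =
        adelicCoeffRep E F 2 (symWeight k) v φ δ w := by
    intro w
    rw [← LinearEquiv.eq_symm_apply]
    -- both sides are linear in `w`; check on pure tensors
    have hlin : (symLatticeAction E E F k v (placeHomInt E F v φ) δ).toAddMonoidHom.comp
          (symLatticeEquivCoeff E F k).symm.toLinearMap.toAddMonoidHom =
        (symLatticeEquivCoeff E F k).symm.toLinearMap.toAddMonoidHom.comp
          (adelicCoeffRep E F 2 (symWeight k) v φ δ).toAddMonoidHom := by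
      refine congrArg LinearMap.toAddMonoidHom (show (symLatticeAction E E F k v (placeHomInt E F v φ) δ) ∘ₗ
          (symLatticeEquivCoeff E F k).symm.toLinearMap =
        (symLatticeEquivCoeff E F k).symm.toLinearMap ∘ₗ adelicCoeffRep E F 2 (symWeight k) v φ δ from ?_)
      refine PiTensorProduct.ext (MultilinearMap.ext fun x => ?_)
      change symLatticeAction E E F k v (placeHomInt E F v φ) δ ((symLatticeEquivCoeff E F k).symm (PiTensorProduct.tprod E x)) =
        (symLatticeEquivCoeff E F k).symm (adelicCoeffRep E F 2 (symWeight k) v φ δ (PiTensorProduct.tprod E x))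
      rw [adelicCoeffRep_apply_tprod, symLatticeEquivCoeff_symm_tprod, symLatticeEquivCoeff_symm_tprod,
        symLatticeAction_tprod]
      refine congrArg ltprod (funext fun τ => ?_)
      rw [intMatrixAt_placeHomInt, ← GLnCohomology.symWeightEquiv_coeffRepGL_eq_symPowAction]
    exact (DFunLike.congr_fun hlin w)
  refine LinearMap.ext fun y => ?_
  have hy := h (symLatticeEquivCoeff E F k y)
  rw [LinearEquiv.symm_apply_apply] at hy
  exact hy

end Rational

/-! ### To characteristic `0`: `𝒪 = padicEmbInt F p ⊆ ℚ̄_p` -/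

section CharZero

variable (F : Type) [Field F] [NumberField F] (k : ℕ) (p : ℕ) [Fact p.Prime]

/-- The inclusion `𝒪 ⊆ E₀ ⊆ ℚ̄_p`. [folklore] -/
def padicEmbIntToAlgCl : padicEmbInt F p →+* PadicAlgCl p :=
  (algebraMap (padicEmbField F p) (PadicAlgCl p)).comp (padicEmbInt F p).subtype

/-- Unfolding `padicEmbIntToAlgCl`. [folklore] -/
@[simp]
theorem padicEmbIntToAlgCl_apply (x : padicEmbInt F p) :
    padicEmbIntToAlgCl F p x = ((x : padicEmbField F p) : PadicAlgCl p) :=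
  rfl

/-- `𝒪 → ℚ̄_p` is injective. [folklore] -/
theorem padicEmbIntToAlgCl_injective : Function.Injective (padicEmbIntToAlgCl F p) := fun _ _ h =>
  Subtype.ext (Subtype.ext h)

/-- **Compatibility of the place data**: `(𝒪 ⊆ ℚ̄_p) ∘ σ_τ = φ_τ|_{𝒪_{v(τ)}}`. [folklore] -/
theorem padicEmbIntToAlgCl_comp_padicEmbIntHom (τ : F →+* PadicAlgCl p) :
    (padicEmbIntToAlgCl F p).comp (padicEmbIntHom F p τ) =
      placeHomInt (PadicAlgCl p) F (padicPlace F p) (padicPlaceHom F p) τ :=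
  RingHom.ext fun _ => rfl

/-- **The rational coefficients `⨂_τ Sym^{k−2}(ℚ̄_p²)`** (wrapper `SymCoeffLattice ℚ̄_p ℚ̄_p F k`) with
the integral monoid of the chosen `p`-adic places acting through `φ_τ|_{𝒪_v}`. [cite: Hida1994AIF, §1] -/
abbrev symRationalCoeff :
    integralMonoid F (padicPlace F p) →* Module.End (PadicAlgCl p) (SymCoeffLattice (PadicAlgCl p) (PadicAlgCl p) F k) :=
  symLatticeAction (PadicAlgCl p) (PadicAlgCl p) F k (padicPlace F p)
    (placeHomInt (PadicAlgCl p) F (padicPlace F p) (padicPlaceHom F p))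

/-- **`⨂_τ Sym(𝒪²) →ₛₗ ⨂_τ Sym(ℚ̄_p²)`**, injective and equivariant. [cite: KhareThorne2017, §6.4] -/
abbrev latticeToRational :
    SymCoeffLattice (padicEmbInt F p) (PadicAlgCl p) F k →ₛₗ[padicEmbIntToAlgCl F p]
      SymCoeffLattice (PadicAlgCl p) (PadicAlgCl p) F k :=
  latticeChange (padicEmbInt F p) (PadicAlgCl p) (PadicAlgCl p) F k (padicEmbIntToAlgCl F p)

/-- `latticeToRational` is injective. [folklore] -/
theorem latticeToRational_injective : Function.Injective (latticeToRational F k p) :=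
  latticeChange_injective (padicEmbInt F p) (PadicAlgCl p) F k (padicEmbIntToAlgCl F p)
    (padicEmbIntToAlgCl_injective F p)

/-- **`latticeToRational` is equivariant.** [cite: KhareThorne2017, §6.4] -/
theorem latticeToRational_symLatticeAction (g : integralMonoid F (padicPlace F p))
    (x : SymCoeffLattice (padicEmbInt F p) (PadicAlgCl p) F k) :
    latticeToRational F k p (symLatticeAction (padicEmbInt F p) (PadicAlgCl p) F k (padicPlace F p)
        (padicEmbIntHom F p) g x) =
      symRationalCoeff F k p g (latticeToRational F k p x) := by
  rw [latticeToRational, latticeChange_symLatticeAction]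
  simp_rw [padicEmbIntToAlgCl_comp_padicEmbIntHom]

variable {Γ : Type} [Group Γ] (ι : Γ →* FiniteAdelicGL 2 F) {U : Subgroup (FiniteAdelicGL 2 F)}
  (hU : U.toSubmonoid ≤ integralMonoid F (padicPlace F p)) (i : ℕ)

/-- **`H^i(U, ⨂_τ Sym(𝒪²)) →ₛₗ H^i(U, ⨂_τ Sym(ℚ̄_p²))`** along the coefficientwise inclusion.
[cite: KhareThorne2017, §6.4 (M_𝛌 ⊗_𝒪 E)] -/
def latticeToRationalCohomology :
    LevelAction.cohomology ι (integralMonoid F (padicPlace F p))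
        (symLatticeAction (padicEmbInt F p) (PadicAlgCl p) F k (padicPlace F p) (padicEmbIntHom F p)) U i →ₛₗ[padicEmbIntToAlgCl F p]
      LevelAction.cohomology ι (integralMonoid F (padicPlace F p)) (symRationalCoeff F k p) U i :=
  cohomologySemimap ι (integralMonoid F (padicPlace F p)) _ _ U hU (latticeToRational F k p)
    (fun g x => latticeToRational_symLatticeAction F k p g x) i

/-- `latticeToRationalCohomology` commutes with the Hecke operators. [folklore] -/
theorem latticeToRationalCohomology_heckeCohomology {α : FiniteAdelicGL 2 F}
    (hα : α ∈ integralMonoid F (padicPlace F p))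
    (x : LevelAction.cohomology ι (integralMonoid F (padicPlace F p))
      (symLatticeAction (padicEmbInt F p) (PadicAlgCl p) F k (padicPlace F p) (padicEmbIntHom F p)) U i) :
    latticeToRationalCohomology F k p ι hU i (heckeCohomology ι _ _ U hU hα i x) =
      heckeCohomology ι _ _ U hU hα i (latticeToRationalCohomology F k p ι hU i x) :=
  cohomologySemimap_heckeCohomology ι _ _ _ U hU _ _ hα i x

/-- `symLatticeEquivCoeff` intertwines `symRationalCoeff` with the fact's level action
`padicLevelCoeff`. [folklore] -/
theorem symLatticeEquivCoeff_padic_equivariant (δ : integralMonoid F (padicPlace F p)) :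
    (symLatticeEquivCoeff (PadicAlgCl p) F k : SymCoeffLattice (PadicAlgCl p) (PadicAlgCl p) F k →ₗ[PadicAlgCl p]
        CoeffModule (PadicAlgCl p) F 2 (symWeight k)) ∘ₗ symRationalCoeff F k p δ =
      padicLevelCoeff F 2 (symWeight k) p (integralMonoid F (padicPlace F p)) δ ∘ₗ
        (symLatticeEquivCoeff (PadicAlgCl p) F k : SymCoeffLattice (PadicAlgCl p) (PadicAlgCl p) F k →ₗ[PadicAlgCl p]
          CoeffModule (PadicAlgCl p) F 2 (symWeight k)) :=
  symLatticeEquivCoeff_equivariant (PadicAlgCl p) F k (padicPlace F p) (padicPlaceHom F p) δ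

/-- **`H^i(U, ⨂_τ Sym(ℚ̄_p²)) ≅ H^i(U, ⨂_τ V_{(k−2,0)}(ℚ̄_p))`**, Hecke-equivariantly.
[cite: FultonHarrisGTM129, §6.1 Thm. 6.3] -/
def rationalCohomologyIso :
    LevelAction.cohomology ι (integralMonoid F (padicPlace F p)) (symRationalCoeff F k p) U i ≅
      LevelAction.cohomology ι (integralMonoid F (padicPlace F p))
        (padicLevelCoeff F 2 (symWeight k) p (integralMonoid F (padicPlace F p))) U i :=
  cohomologyIsoOfCoeffEquiv ι (integralMonoid F (padicPlace F p)) (symRationalCoeff F k p)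
    (padicLevelCoeff F 2 (symWeight k) p (integralMonoid F (padicPlace F p))) U
    (symLatticeEquivCoeff (PadicAlgCl p) F k) (symLatticeEquivCoeff_padic_equivariant F k p) i

/-- **`Φ : H^i(U, ⨂_τ Sym^{k−2}(𝒪²)) →ₛₗ H^i(X_U, Ṽ_{symWeight k}(ℚ̄_p))`** — the lattice cohomology of
the coefficients-at-`p` model into the receptacle of `hidaControl_dominantOrdinaryPoint`
(`Γ = GL₂(F)`, `ι = globalEmbedding`). [cite: Hida1994AIF, §1, §3] [cite: KhareThorne2017, §6.4–6.5] -/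
def latticeToParallelWeight {U : Subgroup (FiniteAdelicGL 2 F)}
    (hU : U.toSubmonoid ≤ integralMonoid F (padicPlace F p)) (i : ℕ) :
    LevelAction.cohomology (globalEmbedding 2 F) (integralMonoid F (padicPlace F p))
        (symLatticeAction (padicEmbInt F p) (PadicAlgCl p) F k (padicPlace F p) (padicEmbIntHom F p)) U i →ₛₗ[padicEmbIntToAlgCl F p]
      cohomology (PadicAlgCl p) F 2 (symWeight k) U i :=
  ((levelActionIso F 2 (symWeight k) p (integralMonoid F (padicPlace F p)) U hU i).hom.hom ∘ₗ
      (rationalCohomologyIso F k p (globalEmbedding 2 F) i (U := U)).hom.hom).comp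
    (latticeToRationalCohomology F k p (globalEmbedding 2 F) hU i)

/-- **Hecke-equivariance of `Φ`: `Φ ([U α U] x) = heckeOp … α (Φ x)`** for `α` in the integral monoid
(e.g. the Hecke elements `t_{w,j}`, whose operators on the receptacle are the `heckeT` of the fact).
[cite: Hida1994AIF, §1] [cite: KhareThorne2017, §6.5 Lemma 6.17] -/
theorem latticeToParallelWeight_heckeCohomology {U : Subgroup (FiniteAdelicGL 2 F)}
    (hU : U.toSubmonoid ≤ integralMonoid F (padicPlace F p)) (i : ℕ) {α : FiniteAdelicGL 2 F}
    (hα : α ∈ integralMonoid F (padicPlace F p))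
    (x : LevelAction.cohomology (globalEmbedding 2 F) (integralMonoid F (padicPlace F p))
      (symLatticeAction (padicEmbInt F p) (PadicAlgCl p) F k (padicPlace F p) (padicEmbIntHom F p)) U i) :
    latticeToParallelWeight F k p hU i (heckeCohomology (globalEmbedding 2 F) _ _ U hU hα i x) =
      heckeOp (PadicAlgCl p) F 2 (symWeight k) U i α (latticeToParallelWeight F k p hU i x) := by
  have h := LinearMap.congr_fun (cohomologyIsoOfCoeffEquiv_hom_comp_heckeCohomology (globalEmbedding 2 F)
    (integralMonoid F (padicPlace F p)) (symRationalCoeff F k p)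
    (padicLevelCoeff F 2 (symWeight k) p (integralMonoid F (padicPlace F p))) U
    (symLatticeEquivCoeff (PadicAlgCl p) F k) (symLatticeEquivCoeff_padic_equivariant F k p) hU hα i)
    (latticeToRationalCohomology F k p (globalEmbedding 2 F) hU i x)
  simp only [LinearMap.coe_comp, Function.comp_apply] at h
  change (levelActionIso F 2 (symWeight k) p (integralMonoid F (padicPlace F p)) U hU i).hom.hom
      ((cohomologyIsoOfCoeffEquiv (globalEmbedding 2 F) _ _ _ U _ (symLatticeEquivCoeff_padic_equivariant F k p) i).hom.hom
        (latticeToRationalCohomology F k p (globalEmbedding 2 F) hU i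
          (heckeCohomology (globalEmbedding 2 F) _ _ U hU hα i x))) =
    heckeOp (PadicAlgCl p) F 2 (symWeight k) U i α
      ((levelActionIso F 2 (symWeight k) p (integralMonoid F (padicPlace F p)) U hU i).hom.hom
        ((cohomologyIsoOfCoeffEquiv (globalEmbedding 2 F) _ _ _ U _ (symLatticeEquivCoeff_padic_equivariant F k p) i).hom.hom
          (latticeToRationalCohomology F k p (globalEmbedding 2 F) hU i x)))
  rw [latticeToRationalCohomology_heckeCohomology, h, levelActionIso_hom_heckeCohomology]

/-- `Φ` maps `[U α U]`-eigenvectors with eigenvalue `a ∈ 𝒪` to `heckeOp α`-eigenvectors with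
eigenvalue `a` (in `ℚ̄_p`). [folklore] -/
theorem latticeToParallelWeight_eigenvector {U : Subgroup (FiniteAdelicGL 2 F)}
    (hU : U.toSubmonoid ≤ integralMonoid F (padicPlace F p)) (i : ℕ) {α : FiniteAdelicGL 2 F}
    (hα : α ∈ integralMonoid F (padicPlace F p))
    {x : LevelAction.cohomology (globalEmbedding 2 F) (integralMonoid F (padicPlace F p))
      (symLatticeAction (padicEmbInt F p) (PadicAlgCl p) F k (padicPlace F p) (padicEmbIntHom F p)) U i}
    {a : padicEmbInt F p} (hx : heckeCohomology (globalEmbedding 2 F) _ _ U hU hα i x = a • x) :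
    heckeOp (PadicAlgCl p) F 2 (symWeight k) U i α (latticeToParallelWeight F k p hU i x) =
      padicEmbIntToAlgCl F p a • latticeToParallelWeight F k p hU i x := by
  rw [← latticeToParallelWeight_heckeCohomology F k p hU i hα, hx, map_smulₛₗ]

end CharZero

end Literature.NumberTheory.Automorphic.ParallelWeight
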